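import Mathlib
import HarnessLib
import Summits.HubbardSuperconductivity.HubbardSuperconductivity.Theorems.KLProgrammeKLRegimeEngineIsoSupportCount
import Summits.HubbardSuperconductivity.HubbardSuperconductivity.Theorems.KLProgrammeKLRegimeSectorGramSoftShapedSharp

/-!
# Route `KLProgramme` — ENGINE item stmt-HubbardSuperconductivity-20437, class #6 / (E5-F)ₙ producer, route (M): M1 calibration, piece 2 —
# the iso support count per unit space-time volume IN THE KL REGIME: `#{F̄_{m,ω} ≠ 0}/(βL²) ≤ C·Λ_m³` with ONE absolute constant `C`

Cell gate-hubbard-kl, seat hubbard-kl-k3c2-p2 (g11; owner-designate of M1 + M3 of route (M), pen (R59az)).  `…EngineIsoSupportCount` (p575589 + §2 append) bounds the support count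
of one isotropic multiplier under explicit frame hypotheses (`B : BandBounds a b`, frame `C²` size `A`, coordinate-gradient floor `λ`).  Here those hypotheses are discharged
from the engine's binders exactly as in this lineage's `gram_softShaped_bgmFat_sharp_of_thresholds` (…SectorGramSoftShapedSharp, p552439): window `klWindowC ⊂ [−6/5, −1/10]` with
margin, `B = bandBounds` of that range, frame size `A = κ₀/4` from `FrameOK` in the regime (`norm_iteratedFDeriv_frameShift_le_of_frameOK_regime`) under the thresholds on `c` and `U`,
`λ = (1/2)/√2` from `GeomConstants … (1/2) …` (`coord_floor_of_le_norm_gradient`), `π/β ≤ Λ_m` for `m ≤ n_β`, and `π ≤ Λ_m·L` from `β² ≤ L`: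

* `sectorWidth_two_mul_eq_klScale` — `w_{2m} = 32π·Λ_m`; hence the cell radius is `ρ_m = Λ_m·(1 + 24π·s_max·Dt_min)/(Dt_min − 2A)`;
* **`card_support_klIsoFamily_div_le_of_thresholds`** — `∃ C > 0` (absolute: a closed form in `bandBounds(−6/5,−1/10)` fields and `κ₀`) such that for every admissible
  `(R, c, U, β, μ, K, L, M)` and every `m ≤ nScales β`, `ω`: `#{k : F̄_{m,ω}(k) ≠ 0}/(βL²) ≤ C·Λ_m³`.

With `card_spaceTimeBall_le_real` (`ε·N_R ≤ (2R + 2ε)(2R + 2)²`, p567688 / `eps_mul_nearCount_le`) at `R = ρ/Λ_m` the per-leg near factor of the M3 shape is `≤ (2ρ/Λ_m + 2)³·C·Λ_m³ ≤ C·(2ρ+2Λ_m)³`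
— scale-free; that last multiplication and the choice of `ρ` are M3 proper (T+).  Everything is proved; no definitions; nothing about the model is asserted.
References: BGM 2006 §2.5 (2.57), §2.7 (2.69) [cite: BenfattoGiulianiMastropietro2006].
-/

noncomputable section

namespace Summit.HubbardSuperconductivity.HubbardSuperconductivity.Theorems.EngineV8

set_option linter.dupNamespace false -- summit = problem name (single-conjunct summit), D-0017

open Set Finset Literature.MathematicalPhysics.QuantumLattice Literature.MathematicalPhysics.QuantumLattice.BandSectorCounting
open Literature.MathematicalPhysics.QuantumLattice.FermiRG Literature.Probability.LatticeModels Literature.Analysis.SpecialFunctions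
open Summit.HubbardSuperconductivity.HubbardSuperconductivity.Theorems.DispersionFlow
open Summit.HubbardSuperconductivity.HubbardSuperconductivity.Theorems.KLRegimeSplit
open Summit.HubbardSuperconductivity.HubbardSuperconductivity.Theorems.KLProgrammeLegKernels
open Summit.HubbardSuperconductivity.HubbardSuperconductivity.Theorems.PerturbedFermiCurve
open Summit.HubbardSuperconductivity.HubbardSuperconductivity.Theorems.TorusFourierL2
open scoped Real

section Regime

open Classical

/-- `w_{2m} = 32π·Λ_m` (`sectorWidth (2m) = π/4^m`, `Λ_m = klE0·4^{-m}`, `klE0 = 1/32`). -/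
theorem sectorWidth_two_mul_eq_klScale (m : ℕ) : sectorWidth (2 * m) = 32 * π * klScale klE0 m := by
  rw [sectorWidth, klScale, klE0, pow_mul]
  norm_num
  ring

/-- **THE ISO SUPPORT COUNT PER UNIT SPACE-TIME VOLUME IN THE KL REGIME**: one absolute constant `C` with `#{k : F̄_{m,ω}(k) ≠ 0}/(βL²) ≤ C·Λ_m³` for every admissible
frame/window/coupling/temperature, every volume `L ≥ β²`, every resolution `m ≤ n_β` and sector `ω`. -/
theorem card_support_klIsoFamily_div_le_of_thresholds (ha : (-4 : ℝ) < -(6 / 5)) (hab : (-(6 / 5) : ℝ) ≤ -(1 / 10)) (hb : (-(1 / 10) : ℝ) < 0) :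
    ∃ C : ℝ, 0 < C ∧ ∀ (R : RenConsts), (∀ j, 0 ≤ R.Gfr j) →
      ∀ (c U : ℝ), 0 < c →
      c ≤ min (min ((bandBounds ha hab hb).Dtmin / 4) ((bandBounds ha hab hb).rhomin / 4)) (1 / 40) / (12 * (R.Gfr 2 + 1)) → 0 < U →
      U ≤ min 1 (min (min ((bandBounds ha hab hb).Dtmin / 4) ((bandBounds ha hab hb).rhomin / 4)) (1 / 40) / (24 * (R.Gfr 0 + R.Gfr 1 + 1))) →
      ∀ β : ℝ, klBetaMin ≤ β → β ≤ Real.exp (c / U ^ 2) → ∀ μ ∈ klWindowC, ∀ K : TrigPolyC4v, FrameOK R U (nScales β) μ K →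
      ∀ (L M : ℕ) [NeZero L], β ^ 2 ≤ (L : ℝ) → ∀ m : ℕ, m ≤ nScales β → ∀ ω : Fin (sectorCount (2 * m)),
        ((((univ : Finset (FreqMomentum L M)).filter fun k => klIsoFamily L M β μ K klE0 m ω k ≠ 0).card : ℕ) : ℝ) / (β * (L : ℝ) ^ 2) ≤
          C * klScale klE0 m ^ 3 := by
  classical
  set B : BandBounds (-(6 / 5)) (-(1 / 10)) := bandBounds ha hab hb with hBdef
  set κ₀ : ℝ := min (min (B.Dtmin / 4) (B.rhomin / 4)) (1 / 40) with hκ₀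
  have hDt := B.Dtmin_pos
  have hrh := B.rhomin_pos
  have hκ₀pos : 0 < κ₀ := by rw [hκ₀]; exact lt_min (lt_min (by positivity) (by positivity)) (by norm_num)
  have hκ₀Dt : κ₀ ≤ B.Dtmin / 4 := (min_le_left _ _).trans (min_le_left _ _)
  have hκ₀40 : κ₀ ≤ 1 / 40 := min_le_right _ _
  have he : (0 : ℝ) < klE0 := by norm_num [klE0]
  set A : ℝ := κ₀ / 4 with hAdef
  have hA0 : 0 < A := by rw [hAdef]; positivity
  have hDtA : 0 < B.Dtmin - 2 * A := by rw [hAdef]; linarith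
  have hsm := B.smax_pos
  have hπ := Real.pi_pos
  have hπ3 := Real.pi_gt_three
  -- the gradient floor, the fibre constant, the cell-radius constant, the constant
  obtain ⟨lam, hlam⟩ : ∃ lam : ℝ, lam = (1 / 2 : ℝ) / Real.sqrt 2 := ⟨_, rfl⟩
  have hlam0 : 0 < lam := by rw [hlam]; positivity
  obtain ⟨Kf, hKf⟩ : ∃ Kf : ℝ, Kf = 8 * π * (4 + 4 * A) / lam + 1 := ⟨_, rfl⟩
  have hKf0 : 0 < Kf := by rw [hKf]; positivity
  obtain ⟨Cρ, hCρ⟩ : ∃ Cρ : ℝ, Cρ = 1 + (1 + 24 * π * B.smax * B.Dtmin) / (B.Dtmin - 2 * A) := ⟨_, rfl⟩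
  have hCρ0 : 0 < Cρ := by rw [hCρ]; positivity
  obtain ⟨C, hC⟩ : ∃ C : ℝ, C = 64 * Kf * Cρ / (π ^ 3 * lam) := ⟨_, rfl⟩
  have hC0 : 0 < C := by rw [hC]; positivity
  refine ⟨C, hC0, ?_⟩
  intro R hR c U hc hcle hU hUle β hβmin hβc μ hμ K hK L M _ hLβ m hmN ω
  have hβ0 : 0 < β := pos_of_klBetaMin_le hβmin
  have hβ128 : 128 ≤ β := by simpa [klBetaMin] using hβmin
  have hL0 : (0 : ℝ) < L := lt_of_lt_of_le (by positivity) hLβ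
  -- the frame's `C²` size is `≤ A = κ₀/4` (as in `gram_softShaped_bgmFat_sharp_of_thresholds`)
  have hlog : 1 ≤ Real.log 4 := by
    have h4 : Real.exp 1 ≤ 4 := by have := Real.exp_one_lt_d9; norm_num at this; linarith
    calc (1 : ℝ) = Real.log (Real.exp 1) := (Real.log_exp 1).symm
      _ ≤ Real.log 4 := Real.log_le_log (Real.exp_pos 1) h4
  have hAK : ∀ p : Momentum, ∀ j ≤ 2, ‖iteratedFDeriv ℝ j (frameShift K) p‖ ≤ A := by
    intro p j hj
    refine (norm_iteratedFDeriv_frameShift_le_of_frameOK_regime hR hc.le hβmin hβc hK p hj).trans ?_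
    have h0 := hR 0; have h1 := hR 1; have h2 := hR 2
    have hU1 : U ≤ 1 := hUle.trans (min_le_left _ _)
    have hUk : U ≤ κ₀ / (24 * (R.Gfr 0 + R.Gfr 1 + 1)) := hUle.trans (min_le_right _ _)
    rw [abs_of_pos hU]
    have hU2 : U ^ 2 ≤ U := by nlinarith only [hU, hU1]
    have hA1 : 2 * R.Gfr 0 * U + 2 * R.Gfr 1 * U ^ 2 ≤ 2 * (R.Gfr 0 + R.Gfr 1 + 1) * U := by
      have := mul_le_mul_of_nonneg_left hU2 h1
      linarith only [this, hU.le]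
    have hB1 : 2 * (R.Gfr 0 + R.Gfr 1 + 1) * U ≤ κ₀ / 12 := by
      have hpos : 0 < 24 * (R.Gfr 0 + R.Gfr 1 + 1) := by positivity
      have := (le_div_iff₀ hpos).mp hUk
      linarith only [this]
    have hC1 : R.Gfr 2 * (c / Real.log 4) ≤ R.Gfr 2 * c := mul_le_mul_of_nonneg_left (div_le_self hc.le hlog) h2
    have hD1 : R.Gfr 2 * c ≤ κ₀ / 12 := by
      have hpos : 0 < 12 * (R.Gfr 2 + 1) := by positivity
      have := (le_div_iff₀ hpos).mp hcle
      linarith only [this, hc.le]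
    rw [hAdef]; linarith only [hA1, hB1, hC1, hD1, hκ₀pos]
  -- the window margins
  have hμ' := hμ
  simp only [klWindowC, Set.mem_Icc] at hμ'
  have e1 : (-1.05 : ℝ) = -(21 / 20) := by norm_num
  have e2 : (-0.15 : ℝ) = -(3 / 20) := by norm_num
  have hμlo : -(21 / 20 : ℝ) ≤ μ := by rw [← e1]; exact hμ'.1
  have hμhi : μ ≤ -(3 / 20 : ℝ) := by rw [← e2]; exact hμ'.2
  have he0 : klE0 = 1 / 32 := rfl
  have hlo : (-(6 / 5) : ℝ) ≤ μ - A - klE0 := by rw [he0, hAdef]; linarith only [hμlo, hκ₀40]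
  have hhi : μ + A + klE0 ≤ -(1 / 10) := by rw [he0, hAdef]; linarith only [hμhi, hκ₀40]
  have hADt : 2 * A < B.Dtmin := by rw [hAdef]; linarith
  -- the coordinate-gradient floor of the frame band on the shell `{|e_K| ≤ Λ_m}` (inside the tube `{|e_K| < 3/80}`)
  have hgradK : ∀ p : Fin 2 → ℝ, |frameLevel μ K (WithLp.toLp 2 p)| ≤ klScale klE0 m →
      lam ≤ |fderiv ℝ (fun q : Fin 2 → ℝ => frameLevel μ K (WithLp.toLp 2 q)) p (Pi.single 0 1)| ∨
        lam ≤ |fderiv ℝ (fun q : Fin 2 → ℝ => frameLevel μ K (WithLp.toLp 2 q)) p (Pi.single 1 1)| := by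
    intro p hp
    have htube : |frameLevel μ K (WithLp.toLp 2 p)| < 3 / 80 :=
      lt_of_le_of_lt (hp.trans (klScale_le_e0 he.le m)) (by norm_num [klE0])
    rw [hlam]
    exact coord_floor_of_le_norm_gradient ((EngineV8.contDiff_frameLevel μ K (n := 1)).differentiable one_ne_zero) (by norm_num) p
      (hK.1.le_norm_gradient _ htube)
  -- the scales: `π/β ≤ Λ_m ≤ e₀`, `π ≤ Λ_m L`
  set Λ : ℝ := klScale klE0 m with hΛdef
  have hΛ0 : 0 < Λ := klth_klScale_pos m
  have hanti : ∀ {a b : ℕ}, a ≤ b → klScale klE0 b ≤ klScale klE0 a := fun hab' => by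
    unfold klScale; exact mul_le_mul_of_nonneg_left (inv_anti₀ (by positivity) (pow_le_pow_right₀ (by norm_num) hab')) he.le
  have hΛβ : π / β ≤ Λ := (klth_pi_div_le_klScale_nScales hβmin).trans (hanti hmN)
  have hΛL : π ≤ Λ * L := by
    have h1 : π / β * β ^ 2 ≤ Λ * L := mul_le_mul hΛβ hLβ (by positivity) hΛ0.le
    have e : π / β * β ^ 2 = π * β := by field_simp
    rw [e] at h1
    nlinarith only [h1, hβ128, hπ]
  -- the cell radius in units of `Λ_m`
  set ρ₀ : ℝ := (klScale klE0 m + B.smax * B.Dtmin * (3 * sectorWidth (2 * m) / 4)) / (B.Dtmin - 2 * A) with hρ₀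
  have hρΛ : ρ₀ + Λ = Cρ * Λ := by
    rw [hρ₀, hCρ, sectorWidth_two_mul_eq_klScale, ← hΛdef]
    field_simp
    ring
  -- the three factor bounds (before the count enters the context: `positivity` must not scan it)
  have h1 : Λ / π + 3 / β ≤ 4 * Λ / π := by
    have : 3 / β ≤ 3 * Λ / π := by
      rw [div_le_div_iff₀ hβ0 hπ]
      have := (div_le_iff₀ hβ0).1 hΛβ
      nlinarith [this]
    have e : 4 * Λ / π = Λ / π + 3 * Λ / π := by ring
    linarith [this, e]
  have hρ00 : 0 ≤ ρ₀ := by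
    rw [hρ₀]; have := sectorWidth_pos (2 * m); positivity
  have h2 : 2 * (ρ₀ / π + 1 / L) ≤ 2 * (Cρ * Λ) / π := by
    have : 1 / (L : ℝ) ≤ Λ / π := by rw [div_le_div_iff₀ hL0 hπ]; linarith [hΛL]
    have e : 2 * (Cρ * Λ) / π = 2 * (ρ₀ / π + Λ / π) := by rw [← hρΛ]; ring
    linarith [this, e]
  have h3 : 4 * Λ / (π * lam) + 2 / L ≤ 8 * Λ / (π * lam) := by
    have hlam2 : lam ≤ 2 := by
      rw [hlam]
      have hs1 : 1 ≤ Real.sqrt 2 := by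
        rw [show (1 : ℝ) = Real.sqrt 1 by simp]; exact Real.sqrt_le_sqrt (by norm_num)
      rw [div_le_iff₀ (by positivity)]; linarith
    have : 2 / (L : ℝ) ≤ 4 * Λ / (π * lam) := by
      rw [div_le_div_iff₀ hL0 (by positivity)]
      have h1' : π * lam ≤ π * 2 := mul_le_mul_of_nonneg_left hlam2 hπ.le
      linarith [h1', hΛL]
    have e : 8 * Λ / (π * lam) = 4 * Λ / (π * lam) + 4 * Λ / (π * lam) := by ring
    linarith [this, e]
  have h20 : 0 ≤ 2 * (ρ₀ / π + 1 / L) := by positivity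
  have h30 : 0 ≤ 4 * Λ / (π * lam) + 2 / L := by positivity
  have n1 : 0 ≤ Kf * (4 * Λ / (π * lam) + 2 / L) := mul_nonneg hKf0.le h30
  have n2 : 0 ≤ 2 * (Cρ * Λ) / π := div_nonneg (mul_nonneg zero_le_two (mul_nonneg hCρ0.le hΛ0.le)) hπ.le
  have n3 : 0 ≤ 2 * (ρ₀ / π + 1 / L) * (Kf * (4 * Λ / (π * lam) + 2 / L)) := mul_nonneg h20 n1
  have n4 : 0 ≤ 4 * Λ / π := by positivity
  have hchain : (Λ / π + 3 / β) * (2 * (ρ₀ / π + 1 / L) * (Kf * (4 * Λ / (π * lam) + 2 / L))) ≤ C * Λ ^ 3 :=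
    calc (Λ / π + 3 / β) * (2 * (ρ₀ / π + 1 / L) * (Kf * (4 * Λ / (π * lam) + 2 / L)))
        ≤ (4 * Λ / π) * ((2 * (Cρ * Λ) / π) * (Kf * (8 * Λ / (π * lam)))) :=
          mul_le_mul h1 (mul_le_mul h2 (mul_le_mul_of_nonneg_left h3 hKf0.le) n1 n2) n3 n4
      _ = C * Λ ^ 3 := by rw [hC]; field_simp; ring
  -- the explicit count
  have h := card_support_klIsoFamily_div_le (L := L) (M := M) B hAK hADt he hlo hhi hβ0 m hlam0 hgradK ω
  rw [← hρ₀, ← hΛdef, ← hKf] at h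
  exact h.trans hchain

end Regime

end Summit.HubbardSuperconductivity.HubbardSuperconductivity.Theorems.EngineV8

end
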